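import Mathlib
import HarnessLib
import Summits.HubbardSuperconductivity.HubbardSuperconductivity.Theorems.KLProgrammeKLRegimeSplitTwoLegSizesMSQ
import Summits.HubbardSuperconductivity.HubbardSuperconductivity.Theorems.KLProgrammeKLRegimeSplitTwoLegSizesMSFitSizesOsc
import Summits.HubbardSuperconductivity.HubbardSuperconductivity.Theorems.KLProgrammeKLRegimeSplitTwoLegSizesMSFitPiecesAux
import Summits.HubbardSuperconductivity.HubbardSuperconductivity.Theorems.KLProgrammeKLRegimeSplitTwoLegSizesMSFitReq
import Summits.HubbardSuperconductivity.HubbardSuperconductivity.Theorems.KLProgrammeKLRegimeSplitTwoLegSizesMSFitBaseFits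

/-!
# Route `KLProgramme`, crux K3 — ENGINE child (`KLRegimeEngineV16`, `stub_twoLeg_step` at the TOP scale `n = n_β + 1`, clause (E3a-MS-Q)):
# the top fit `msPieceTop … j ≤ twoLegBar G Q U j (n_β+1)` from the engine profile and the BASE package lines, and the top supplier
# `TwoLegSizesMSTQ … (nScales β + 1)` with no fit hypothesis left (k3c3-p1 g4)

Seat hubbard-kl-k3c3-p1 (g4).  At the top scale there are no slots: `twoLegSizesMSTQ_top_of_frameOK` (`…TwoLegSizesMSQ`) needs the single fit
`∀ j ≤ 4, msPieceTop X σ R U N j ≤ twoLegBar G Q U j (N+1)` (`N = nScales β`), where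
`msPieceTop X σ R U N j = extSize X (σ 0) (bellCumOsc σ (msD (topA3 R U N) (topA4 R U N)) j) j = msSizeBaseO X (fun _ ↦ σ) (topA3 R U N) (topA4 R U N) j`.
This is the BASE fit of k3c3-p3's arithmetic (`ms_base_fit_zero … four`, `…MSFitBaseFits`) at `y = 4^{N+1}` with the frame budgets
`topA3 R U N = Gfr₃U²4^{N+1}/3`, `topA4 R U N = Gfr₄U²16^{N+1}/15` in place of `msA3L/msA4L` — both below the shapes those lemmas take
(`topA3_le_shape`, `topA4_le_shape`).  Hence:

* **`msPieceTop_le`** — `∀ j ≤ 4, msPieceTop X σ R U N j ≤ twoLegBar G Q U j (N+1)` from `0 < U ≤ 1`, `0 ≤ X`, the top increment profile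
  `σ 0 ≤ 16·mu 0·U²/y²`, `σ 1 ≤ 4·mu 1·U²/y`, `σ 2 ≤ mu 2·U²`, `σ 3 ≤ mu 3·U²·y/4`, `σ 4 ≤ mu 4·U²·y²/16` (`y = 4^{N+1}`) and the SAME base package
  lines as the lower scales: `msReqBase0 X mu j ≤ G.S j/2`, `U·msReqBase1 X mu R lam3 lam4 j ≤ G.S j/2` (any `lam3, lam4 ≥ 0`);
* **`twoLegSizesMSTQ_top_of_profiles`** — `TwoLegSizesMSTQ L M G Q R β U μ K (nScales β + 1)` from the regime, `FrameOK`, the engine's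
  representation `hS` of the last local-part increment with sizes `σ l`, the cutoff bound `X`, the profile lines and the two package lines.

Proofs only; nothing about the model.
-/

noncomputable section

namespace Summit.HubbardSuperconductivity.HubbardSuperconductivity.Theorems.KLRegimeSplit

set_option linter.dupNamespace false -- summit = problem name (single-conjunct summit), D-0017

open Real Finset Literature.MathematicalPhysics.QuantumLattice Literature.MathematicalPhysics.QuantumLattice.FermiRG
open Summit.HubbardSuperconductivity.HubbardSuperconductivity.Theorems.KLProgrammeLegKernels
open Summit.HubbardSuperconductivity.HubbardSuperconductivity.Theorems.DispersionFlow
open Summit.HubbardSuperconductivity.HubbardSuperconductivity.Theorems.PerturbedFermiCurve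

/-! ## §1 The top size is a base size at the frame budgets -/

/-- `msPieceTop` is the base size shape `msSizeBaseO` of the constant table `fun _ ↦ σ` at the frame budgets `topA3`, `topA4`. -/
theorem msPieceTop_eq_msSizeBaseO (X : ℝ) (σ : ℕ → ℝ) (R : RenConsts) (U : ℝ) (N j : ℕ) :
    msPieceTop X σ R U N j = msSizeBaseO X (fun _ => σ) (topA3 R U N) (topA4 R U N) j := rfl

/-- `0 ≤ topA3 R U N`. -/
theorem topA3_nonneg {R : RenConsts} (hR : ∀ j, 0 ≤ R.Gfr j) (U : ℝ) (N : ℕ) : 0 ≤ topA3 R U N := by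
  have := hR 3; unfold topA3; positivity

/-- `0 ≤ topA4 R U N`. -/
theorem topA4_nonneg {R : RenConsts} (hR : ∀ j, 0 ≤ R.Gfr j) (U : ℝ) (N : ℕ) : 0 ≤ topA4 R U N := by
  have := hR 4; unfold topA4; positivity

/-- The frame order-3 budget is below the order-3 shape of the base fit at `y = 4^{N+1}`: `Gfr₃U²y/3 ≤ (4/3 + 16/3)·Gfr₃U²y + lam3·Gfr₁U²y`. -/
theorem topA3_le_shape {R : RenConsts} (hR : ∀ j, 0 ≤ R.Gfr j) (U : ℝ) (N : ℕ) {lam3 : ℝ} (hlam3 : 0 ≤ lam3) :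
    topA3 R U N ≤ 4 / 3 * R.Gfr 3 * U ^ 2 * (4 : ℝ) ^ (N + 1) + lam3 * R.Gfr 1 * U ^ 2 * (4 : ℝ) ^ (N + 1) +
      16 / 3 * R.Gfr 3 * U ^ 2 * (4 : ℝ) ^ (N + 1) := by
  have h3 := hR 3
  have h1 := hR 1
  have hy : (0 : ℝ) ≤ (4 : ℝ) ^ (N + 1) := by positivity
  have hA : 0 ≤ R.Gfr 3 * U ^ 2 * (4 : ℝ) ^ (N + 1) := by positivity
  have hB : 0 ≤ lam3 * R.Gfr 1 * U ^ 2 * (4 : ℝ) ^ (N + 1) := by positivity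
  calc topA3 R U N = 1 / 3 * (R.Gfr 3 * U ^ 2 * (4 : ℝ) ^ (N + 1)) := by unfold topA3; ring
    _ ≤ 20 / 3 * (R.Gfr 3 * U ^ 2 * (4 : ℝ) ^ (N + 1)) + lam3 * R.Gfr 1 * U ^ 2 * (4 : ℝ) ^ (N + 1) := by nlinarith
    _ = _ := by ring

/-- The frame order-4 budget is below the order-4 shape of the base fit at `y = 4^{N+1}`: `Gfr₄U²y²/15 ≤ (16/15 + 64/15)·Gfr₄U²y² + lam4·Gfr₁U²y²`. -/
theorem topA4_le_shape {R : RenConsts} (hR : ∀ j, 0 ≤ R.Gfr j) (U : ℝ) (N : ℕ) {lam4 : ℝ} (hlam4 : 0 ≤ lam4) :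
    topA4 R U N ≤ 16 / 15 * R.Gfr 4 * U ^ 2 * ((4 : ℝ) ^ (N + 1)) ^ 2 + lam4 * R.Gfr 1 * U ^ 2 * ((4 : ℝ) ^ (N + 1)) ^ 2 +
      64 / 15 * R.Gfr 4 * U ^ 2 * ((4 : ℝ) ^ (N + 1)) ^ 2 := by
  have h4 := hR 4
  have h1 := hR 1
  have hA : 0 ≤ R.Gfr 4 * U ^ 2 * ((4 : ℝ) ^ (N + 1)) ^ 2 := by positivity
  have hB : 0 ≤ lam4 * R.Gfr 1 * U ^ 2 * ((4 : ℝ) ^ (N + 1)) ^ 2 := by positivity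
  calc topA4 R U N = 1 / 15 * (R.Gfr 4 * U ^ 2 * ((4 : ℝ) ^ (N + 1)) ^ 2) := by
        unfold topA4; rw [sixteen_pow_eq_four_sq]; ring
    _ ≤ 80 / 15 * (R.Gfr 4 * U ^ 2 * ((4 : ℝ) ^ (N + 1)) ^ 2) + lam4 * R.Gfr 1 * U ^ 2 * ((4 : ℝ) ^ (N + 1)) ^ 2 := by nlinarith
    _ = _ := by ring

/-- `4 ≤ 4^{N+1}`. -/
theorem four_le_four_pow_succ (N : ℕ) : (4 : ℝ) ≤ (4 : ℝ) ^ (N + 1) := le_self_pow₀ (by norm_num) (Nat.succ_ne_zero N)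

/-! ## §2 The top fit, order by order -/

section Top

variable {G : GeoConsts} {Q : EngConsts} {R : RenConsts} {X U lam3 lam4 : ℝ} {σ mu : ℕ → ℝ} {N : ℕ}

/-- **Top fit, order 0.** -/
theorem msPieceTop_le_zero (hU : 0 < U) (hU1 : U ≤ 1) (hX : 0 ≤ X) (hS' : 0 ≤ Q.S' 0) (hmu : ∀ i, 0 ≤ mu i)
    (hσ0 : ∀ i, 0 ≤ σ i) (hs0 : σ 0 ≤ 16 * mu 0 * U ^ 2 / ((4 : ℝ) ^ (N + 1)) ^ 2)
    (hfit0 : msReqBase0 X mu 0 ≤ G.S 0 / 2) (hfit1 : U * msReqBase1 X mu R lam3 lam4 0 ≤ G.S 0 / 2) :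
    msPieceTop X σ R U N 0 ≤ twoLegBar G Q U 0 (N + 1) := by
  have hfit0' : 16 * (mu 0) + 64 * (X * mu 0) ≤ G.S 0 / 2 := hfit0
  have hfit1' : U * (0) ≤ G.S 0 / 2 := hfit1
  have h1 := msSizeBaseO_le_zero (X := X) (σ := fun _ => σ) (A₃ := topA3 R U N) (A₄ := topA4 R U N) (hX := hX)
  have h2 := ms_base_fit_zero (X := X) (U := U) (y := (4 : ℝ) ^ (N + 1)) (S := G.S 0) (S' := Q.S' 0) (σ0 := σ) (μ := mu)
    (hX := hX) (hU := hU) (hU1 := hU1) (hy := four_le_four_pow_succ N) (hS' := hS') (hμ := hmu) (hσ0 := hσ0)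
    (hs0 := hs0) (hfit0 := hfit0') (hfit1 := hfit1')
  rw [msPieceTop_eq_msSizeBaseO, (twoLegBar_graded G Q hU (N + 1)).1]
  exact h1.trans h2

/-- **Top fit, order 1.** -/
theorem msPieceTop_le_one (hU : 0 < U) (hU1 : U ≤ 1) (hX : 0 ≤ X) (hS' : 0 ≤ Q.S' 1) (hmu : ∀ i, 0 ≤ mu i)
    (hσ0 : ∀ i, 0 ≤ σ i) (hs1 : σ 1 ≤ 4 * mu 1 * U ^ 2 / (4 : ℝ) ^ (N + 1))
    (hfit0 : msReqBase0 X mu 1 ≤ G.S 1 / 2) (hfit1 : U * msReqBase1 X mu R lam3 lam4 1 ≤ G.S 1 / 2) :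
    msPieceTop X σ R U N 1 ≤ twoLegBar G Q U 1 (N + 1) := by
  have hfit0' : 13520000 * (X * mu 1) ≤ G.S 1 / 2 := hfit0
  have hfit1' : U * (0) ≤ G.S 1 / 2 := hfit1
  have h1 := msSizeBaseO_le_one (X := X) (σ := fun _ => σ) (A₃ := topA3 R U N) (A₄ := topA4 R U N) (hX := hX) (hσ := fun _ i => hσ0 i)
  have h2 := ms_base_fit_one (X := X) (U := U) (y := (4 : ℝ) ^ (N + 1)) (S := G.S 1) (S' := Q.S' 1) (σ0 := σ) (μ := mu)
    (hX := hX) (hU := hU) (hU1 := hU1) (hy := four_le_four_pow_succ N) (hS' := hS') (hμ := hmu) (hσ0 := hσ0)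
    (hs1 := hs1) (hfit0 := hfit0') (hfit1 := hfit1')
  rw [msPieceTop_eq_msSizeBaseO, (twoLegBar_graded G Q hU (N + 1)).2.1]
  exact h1.trans h2

/-- **Top fit, order 2.** -/
theorem msPieceTop_le_two (hU : 0 < U) (hU1 : U ≤ 1) (hX : 0 ≤ X) (hS' : 0 ≤ Q.S' 2) (hmu : ∀ i, 0 ≤ mu i)
    (hσ0 : ∀ i, 0 ≤ σ i) (hs1 : σ 1 ≤ 4 * mu 1 * U ^ 2 / (4 : ℝ) ^ (N + 1)) (hs2 : σ 2 ≤ mu 2 * U ^ 2)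
    (hfit0 : msReqBase0 X mu 2 ≤ G.S 2 / 2) (hfit1 : U * msReqBase1 X mu R lam3 lam4 2 ≤ G.S 2 / 2) :
    msPieceTop X σ R U N 2 ≤ twoLegBar G Q U 2 (N + 1) := by
  have hfit0' : 11232000000000 * (X * mu 1) + 854400000000 * (X * mu 2) ≤ G.S 2 / 2 := hfit0
  have hfit1' : U * (0) ≤ G.S 2 / 2 := hfit1
  have h1 := msSizeBaseO_le_two (X := X) (σ := fun _ => σ) (A₃ := topA3 R U N) (A₄ := topA4 R U N) (hX := hX) (hσ := fun _ i => hσ0 i)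
  have h2 := ms_base_fit_two (X := X) (U := U) (y := (4 : ℝ) ^ (N + 1)) (S := G.S 2) (S' := Q.S' 2) (σ0 := σ) (μ := mu)
    (hX := hX) (hU := hU) (hU1 := hU1) (hy := four_le_four_pow_succ N) (hS' := hS') (hμ := hmu) (hσ0 := hσ0)
    (hs1 := hs1) (hs2 := hs2) (hfit0 := hfit0') (hfit1 := hfit1')
  rw [msPieceTop_eq_msSizeBaseO, (twoLegBar_graded G Q hU (N + 1)).2.2.1]
  exact h1.trans h2

/-- **Top fit, order 3.** -/
theorem msPieceTop_le_three (hR : ∀ j, 0 ≤ R.Gfr j) (hU : 0 < U) (hU1 : U ≤ 1) (hX : 0 ≤ X) (hlam3 : 0 ≤ lam3) (hS' : 0 ≤ Q.S' 3)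
    (hmu : ∀ i, 0 ≤ mu i) (hσ0 : ∀ i, 0 ≤ σ i) (hs1 : σ 1 ≤ 4 * mu 1 * U ^ 2 / (4 : ℝ) ^ (N + 1)) (hs2 : σ 2 ≤ mu 2 * U ^ 2)
    (hs3 : σ 3 ≤ mu 3 * U ^ 2 * (4 : ℝ) ^ (N + 1) / 4)
    (hfit0 : msReqBase0 X mu 3 ≤ G.S 3 / 2) (hfit1 : U * msReqBase1 X mu R lam3 lam4 3 ≤ G.S 3 / 2) :
    msPieceTop X σ R U N 3 ≤ twoLegBar G Q U 3 (N + 1) := by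
  have hfit0' : 813902985000000000000 * (X * mu 1) + 60761421000000000000 * (X * mu 2) + 1550291400000000000 * (X * mu 3) ≤ G.S 3 / 2 :=
    hfit0
  have hfit1' : U * (533433600000000000000 * (X * R.Gfr 3 * mu 1) + 80015040000000000000 * (X * R.Gfr 1 * lam3 * mu 1)) ≤ G.S 3 / 2 :=
    hfit1
  have h1 := msSizeBaseO_le_three (X := X) (σ := fun _ => σ) (A₃ := topA3 R U N) (A₄ := topA4 R U N) (hX := hX)
    (hσ := fun _ i => hσ0 i) (hA₃ := topA3_nonneg hR U N)
  have h2 := ms_base_fit_three (X := X) (U := U) (y := (4 : ℝ) ^ (N + 1)) (S := G.S 3) (S' := Q.S' 3) (σ0 := σ) (μ := mu)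
    (A₃ := topA3 R U N) (G1 := R.Gfr 1) (G3 := R.Gfr 3) (lam3 := lam3)
    (hX := hX) (hU := hU) (hU1 := hU1) (hy := four_le_four_pow_succ N) (hG1 := hR 1) (hG3 := hR 3) (hlam3 := hlam3)
    (hS' := hS') (hμ := hmu) (hA₃0 := topA3_nonneg hR U N) (hA₃ := topA3_le_shape hR U N hlam3) (hσ0 := hσ0)
    (hs1 := hs1) (hs2 := hs2) (hs3 := hs3) (hfit0 := hfit0') (hfit1 := hfit1')
  rw [msPieceTop_eq_msSizeBaseO, (twoLegBar_graded G Q hU (N + 1)).2.2.2.1]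
  exact h1.trans h2

/-- **Top fit, order 4.** -/
theorem msPieceTop_le_four (hR : ∀ j, 0 ≤ R.Gfr j) (hU : 0 < U) (hU1 : U ≤ 1) (hX : 0 ≤ X) (hlam3 : 0 ≤ lam3) (hlam4 : 0 ≤ lam4)
    (hS' : 0 ≤ Q.S' 4) (hmu : ∀ i, 0 ≤ mu i) (hσ0 : ∀ i, 0 ≤ σ i) (hs1 : σ 1 ≤ 4 * mu 1 * U ^ 2 / (4 : ℝ) ^ (N + 1))
    (hs2 : σ 2 ≤ mu 2 * U ^ 2) (hs3 : σ 3 ≤ mu 3 * U ^ 2 * (4 : ℝ) ^ (N + 1) / 4)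
    (hs4 : σ 4 ≤ mu 4 * U ^ 2 * ((4 : ℝ) ^ (N + 1)) ^ 2 / 16)
    (hfit0 : msReqBase0 X mu 4 ≤ G.S 4 / 2) (hfit1 : U * msReqBase1 X mu R lam3 lam4 4 ≤ G.S 4 / 2) :
    msPieceTop X σ R U N 4 ≤ twoLegBar G Q U 4 (N + 1) := by
  have hfit0' : 988426055880000000000000000000 * (X * mu 1) + 74605720464000000000000000000 * (X * mu 2) +
      2244156030000000000000000000 * (X * mu 3) + 28425976380000000000000000 * (X * mu 4) ≤ G.S 4 / 2 := hfit0
  have hfit1' : U * (30640210329600000000000000000 * (X * R.Gfr 4 * mu 1) + 5745039436800000000000000000 * (X * R.Gfr 1 * lam4 * mu 1) +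
      1252737766080000000000000000000 * (X * R.Gfr 3 * mu 1) + 187910664912000000000000000000 * (X * R.Gfr 1 * lam3 * mu 1) +
      39364159104000000000000000000 * (X * R.Gfr 3 * mu 2) + 5904623865600000000000000000 * (X * R.Gfr 1 * lam3 * mu 2)) ≤ G.S 4 / 2 := hfit1
  have h1 := msSizeBaseO_le_four (X := X) (σ := fun _ => σ) (A₃ := topA3 R U N) (A₄ := topA4 R U N) (hX := hX)
    (hσ := fun _ i => hσ0 i) (hA₃ := topA3_nonneg hR U N) (hA₄ := topA4_nonneg hR U N)
  have h2 := ms_base_fit_four (X := X) (U := U) (y := (4 : ℝ) ^ (N + 1)) (S := G.S 4) (S' := Q.S' 4) (σ0 := σ) (μ := mu)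
    (A₃ := topA3 R U N) (A₄ := topA4 R U N) (G1 := R.Gfr 1) (G3 := R.Gfr 3) (G4 := R.Gfr 4) (lam3 := lam3) (lam4 := lam4)
    (hX := hX) (hU := hU) (hU1 := hU1) (hy := four_le_four_pow_succ N) (hG1 := hR 1) (hG3 := hR 3) (hG4 := hR 4)
    (hlam3 := hlam3) (hlam4 := hlam4) (hS' := hS') (hμ := hmu) (hA₃0 := topA3_nonneg hR U N) (hA₃ := topA3_le_shape hR U N hlam3)
    (hA₄0 := topA4_nonneg hR U N) (hA₄ := topA4_le_shape hR U N hlam4) (hσ0 := hσ0)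
    (hs1 := hs1) (hs2 := hs2) (hs3 := hs3) (hs4 := hs4) (hfit0 := hfit0') (hfit1 := hfit1')
  rw [msPieceTop_eq_msSizeBaseO, (twoLegBar_graded G Q hU (N + 1)).2.2.2.2]
  exact h1.trans h2

/-- **THE TOP FIT, all orders `j ≤ 4`** — the literal `hfit` input of `twoLegSizesMSTQ_top_of_frameOK`. -/
theorem msPieceTop_le (hR : ∀ j, 0 ≤ R.Gfr j) (hU : 0 < U) (hU1 : U ≤ 1) (hX : 0 ≤ X) (hlam3 : 0 ≤ lam3) (hlam4 : 0 ≤ lam4)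
    (hS' : ∀ j, 0 ≤ Q.S' j) (hmu : ∀ i, 0 ≤ mu i) (hσ0 : ∀ i, 0 ≤ σ i)
    (hs0 : σ 0 ≤ 16 * mu 0 * U ^ 2 / ((4 : ℝ) ^ (N + 1)) ^ 2) (hs1 : σ 1 ≤ 4 * mu 1 * U ^ 2 / (4 : ℝ) ^ (N + 1))
    (hs2 : σ 2 ≤ mu 2 * U ^ 2) (hs3 : σ 3 ≤ mu 3 * U ^ 2 * (4 : ℝ) ^ (N + 1) / 4)
    (hs4 : σ 4 ≤ mu 4 * U ^ 2 * ((4 : ℝ) ^ (N + 1)) ^ 2 / 16)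
    (hfit0 : ∀ j ≤ 4, msReqBase0 X mu j ≤ G.S j / 2) (hfit1 : ∀ j ≤ 4, U * msReqBase1 X mu R lam3 lam4 j ≤ G.S j / 2) :
    ∀ j ≤ 4, msPieceTop X σ R U N j ≤ twoLegBar G Q U j (N + 1) := by
  intro j hj
  interval_cases j
  · exact msPieceTop_le_zero hU hU1 hX (hS' 0) hmu hσ0 hs0 (hfit0 0 (by norm_num)) (hfit1 0 (by norm_num))
  · exact msPieceTop_le_one hU hU1 hX (hS' 1) hmu hσ0 hs1 (hfit0 1 (by norm_num)) (hfit1 1 (by norm_num))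
  · exact msPieceTop_le_two hU hU1 hX (hS' 2) hmu hσ0 hs1 hs2 (hfit0 2 (by norm_num)) (hfit1 2 (by norm_num))
  · exact msPieceTop_le_three hR hU hU1 hX hlam3 (hS' 3) hmu hσ0 hs1 hs2 hs3 (hfit0 3 (by norm_num)) (hfit1 3 (by norm_num))
  · exact msPieceTop_le_four hR hU hU1 hX hlam3 hlam4 (hS' 4) hmu hσ0 hs1 hs2 hs3 hs4 (hfit0 4 le_rfl) (hfit1 4 le_rfl)

end Top

/-! ## §3 The top supplier with no fit hypothesis left -/

section MS

variable {L M : ℕ} [NeZero L] [NeZero M] {G : GeoConsts} {Q : EngConsts} {R : RenConsts} {β U μ : ℝ}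

/-- **(E3a-MS-TQ) AT THE TOP SCALE `n = n_β + 1` FROM THE ENGINE PROFILE** — `TwoLegSizesMSTQ … (nScales β + 1)`: the `FrameOK`-keyed top
supplier `twoLegSizesMSTQ_top_of_frameOK`, its one fit discharged by `msPieceTop_le` (the base package lines at `y = 4^{n_β+1}`). -/
theorem twoLegSizesMSTQ_top_of_profiles (hR : ∀ j, 0 ≤ R.Gfr j) {c : ℝ} (hc : 0 < c) (hcle : c ≤ klCurveC3 R)
    (hU : 0 < U) (hUle : U ≤ klCurveU0 R) (hU1 : U ≤ 1) (hβmin : klBetaMin ≤ β) (hβc : β ≤ Real.exp (c / U ^ 2)) (hμ : μ ∈ klWindowC)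
    {K : TrigPolyC4v} (hK : FrameOK R U (nScales β) μ K)
    (hc₁ : Continuous (klLocalPart L M β U μ K (nScales β + 1))) (hc₀ : Continuous (klLocalPart L M β U μ K (nScales β)))
    {S : TrigPolyC4v}
    (hS : ∀ θ, klLocalPart L M β U μ K (nScales β + 1) θ - klLocalPart L M β U μ K (nScales β) θ = S.eval (klFermiPoint μ K θ))
    {σ : ℕ → ℝ} (hσnn : ∀ l, 0 ≤ σ l) (hσ0 : ∀ q : Momentum, |evalM S q| ≤ σ 0)
    (hσ : ∀ l, 1 ≤ l → l ≤ 4 → ∀ q : Momentum, ‖iteratedFDeriv ℝ l (evalM S) q‖ ≤ σ l)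
    {X : ℝ} (hX : ∀ l ≤ 4, ∀ x : ℝ, ‖iteratedFDeriv ℝ l salmhoferCutoff x‖ ≤ X)
    (hS' : ∀ j, 0 ≤ Q.S' j) {mu : ℕ → ℝ} (hmu : ∀ i, 0 ≤ mu i)
    (hs0 : σ 0 ≤ 16 * mu 0 * U ^ 2 / ((4 : ℝ) ^ (nScales β + 1)) ^ 2) (hs1 : σ 1 ≤ 4 * mu 1 * U ^ 2 / (4 : ℝ) ^ (nScales β + 1))
    (hs2 : σ 2 ≤ mu 2 * U ^ 2) (hs3 : σ 3 ≤ mu 3 * U ^ 2 * (4 : ℝ) ^ (nScales β + 1) / 4)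
    (hs4 : σ 4 ≤ mu 4 * U ^ 2 * ((4 : ℝ) ^ (nScales β + 1)) ^ 2 / 16)
    {lam3 lam4 : ℝ} (hlam3 : 0 ≤ lam3) (hlam4 : 0 ≤ lam4)
    (hfit0 : ∀ j ≤ 4, msReqBase0 X mu j ≤ G.S j / 2) (hfit1 : ∀ j ≤ 4, U * msReqBase1 X mu R lam3 lam4 j ≤ G.S j / 2) :
    TwoLegSizesMSTQ L M G Q R β U μ K (nScales β + 1) :=
  twoLegSizesMSTQ_top_of_frameOK hR hc hcle hU hUle hβmin hβc hμ hK hc₁ hc₀ hS hσnn hσ0 hσ hX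
    (msPieceTop_le hR hU hU1 (le_trans (norm_nonneg _) (hX 0 (by norm_num) 0)) hlam3 hlam4 hS' hmu hσnn hs0 hs1 hs2 hs3 hs4
      hfit0 hfit1)

end MS

end Summit.HubbardSuperconductivity.HubbardSuperconductivity.Theorems.KLRegimeSplit

end
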